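import Summits.MatrixMultiplication.MatrixMultiplication.Theses.ProbeRankScaling

-- single-conjunct summit: the mandated namespace `Summit.MatrixMultiplication.MatrixMultiplication.…`
-- repeats the summit name by design (D-0017), which the `dupNamespace` linter would flag.
set_option linter.dupNamespace false

/-!
# MatrixMultiplication / ProbeRankScaling — support `HalfScaleTransfer`
(stmt-MatrixMultiplication-10208)

The recursion chord of the probe-rank filtration at scale one-half, contrapositive form:

  fix `δ > 0`; if for infinitely many `n` every decomposition
  `⟨n,n,n⟩ = ∑ₗ wₗ ⊗ uₗ ⊗ vₗ` over `ℂ` all of whose probes have `rank² ≤ n` has at least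
  `n^(5/2+δ)` terms, then `m^(2+δ) < R(⟨m,m,m⟩)` for infinitely many `m`.

Proof (block embedding = Kronecker product with the schoolbook algorithm, folded together with
the zero-padding). For such an `n` (taken `≥ M²`, `M = max n₀ N₁ 1`) put `m = ⌊√n⌋ ≥ M`, so
`m² ≤ n ≤ (m+2)·m` (`Nat.sqrt_le_add`). Along the injection `e : Fin n ↪ Fin (m+2) × Fin m`
(block index, offset) every index of `⟨n,n,n⟩` gets a block and an offset; a rank-attaining
decomposition `⟨m,m,m⟩ = ∑ₗ wₗ ⊗ uₗ ⊗ vₗ` (`R = R(⟨m,m,m⟩)` terms, the infimum is attained: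
`exists_triad_decomposition_tensorRank`) placed in every block triple `(I,J,K)` — the `w`-probe in
block `(I,K)`, the `u`-probe in block `(I,J)`, the `v`-probe in block `(J,K)` — is a
decomposition of `⟨n,n,n⟩` with `R·(m+2)³` terms (`matMulTensor_eq_sum_blockTriad`: the block
pattern is the schoolbook tensor `⟨m+2⟩`, the offsets carry `⟨m⟩`, and `e` is injective).
Each embedded probe factors as `P·X·Q` with `P` an `n × m` matrix, so its rank is `≤ m`
(`rank_blockProbe_le`) and `rank² ≤ m² ≤ n`. The hypothesis gives `n^(5/2+δ) ≤ R·(m+2)³`, while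
`m^(5+2δ) ≤ n^(5/2+δ)`, `(m+2)³ ≤ 27·m³` and `27 < m^δ` for `m ≥ N₁(δ)`; so `R ≤ m^(2+δ)` would
give `m^(5+2δ) ≤ m^(2+δ)·27·m³ < m^(2+δ)·m^δ·m³ = m^(5+2δ)`, absurd.

References: M. Bläser, *Fast Matrix Multiplication*, Theory of Computing Graduate Surveys 5
(2013), §4 (rank, attained infimum), §5 (`⟨k,m,n⟩`, block recursion / Lemma 5.8 with the
schoolbook factor); V. Strassen, Gaussian elimination is not optimal, Numer. Math. 13 (1969)
(block recursion).
-/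

noncomputable section

open Filter

namespace Summit.MatrixMultiplication.MatrixMultiplication.Theorems

open Literature.Computability.AlgebraicComplexity

/-- Rank of a block-embedded probe: placing `x ∈ M_m(ℂ)` into block `(I, K)` of `M_n(ℂ)` along
`e : Fin n → Fin q × Fin m` (block, offset) gives the matrix `P·X·Q` with `P ∈ ℂ^{n×m}`, hence
of rank `≤ m`. [folklore] -/
theorem rank_blockProbe_le {n m q : ℕ} (e : Fin n → Fin q × Fin m) (I K : Fin q)
    (x : Fin m × Fin m → ℂ) :
    (Matrix.of (Function.curry (fun a : Fin n × Fin n =>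
      if (e a.1).1 = I ∧ (e a.2).1 = K then x ((e a.1).2, (e a.2).2) else 0))).rank ≤ m := by
  classical
  set P : Matrix (Fin n) (Fin m) ℂ :=
    Matrix.of fun a y => if (e a).1 = I ∧ (e a).2 = y then (1 : ℂ) else 0 with hP
  set Q : Matrix (Fin m) (Fin n) ℂ :=
    Matrix.of fun z a => if (e a).1 = K ∧ (e a).2 = z then (1 : ℂ) else 0 with hQ
  set X : Matrix (Fin m) (Fin m) ℂ := Matrix.of (Function.curry x) with hX
  have hfac : Matrix.of (Function.curry (fun a : Fin n × Fin n =>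
      if (e a.1).1 = I ∧ (e a.2).1 = K then x ((e a.1).2, (e a.2).2) else 0)) = P * X * Q := by
    ext a₁ a₂
    simp only [Matrix.mul_apply, Matrix.of_apply, Function.curry_apply, hP, hQ, hX]
    by_cases h₁ : (e a₁).1 = I
    · by_cases h₂ : (e a₂).1 = K
      · simp [h₁, h₂, Finset.sum_ite_eq]
      · simp [h₁, h₂]
    · simp [h₁]
  rw [hfac]
  calc (P * X * Q).rank ≤ (P * X).rank := Matrix.rank_mul_le_left _ _
    _ ≤ P.rank := Matrix.rank_mul_le_left _ _
    _ ≤ m := Matrix.rank_le_width P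

/-- The block decomposition: a decomposition `⟨m,m,m⟩ = ∑ₗ wₗ ⊗ uₗ ⊗ vₗ` with `R` triads and an
injection `e : Fin n → Fin q × Fin m` (block, offset) give the decomposition of `⟨n,n,n⟩` into the
`R·q³` triads indexed by `(l, I, J, K)` whose probes are `wₗ`, `uₗ`, `vₗ` embedded into the blocks
`(I,K)`, `(I,J)`, `(J,K)` (Kronecker product with the schoolbook algorithm `⟨q,q,q⟩`, restricted
along `e`). [folklore] -/
theorem matMulTensor_eq_sum_blockTriad {n m q R : ℕ} (e : Fin n → Fin q × Fin m)
    (he : Function.Injective e) (w u v : Fin R → Fin m × Fin m → ℂ)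
    (h : matMulTensor ℂ m m m = ∑ l, triad (w l) (u l) (v l)) :
    matMulTensor ℂ n n n = ∑ p : Fin R × Fin q × Fin q × Fin q,
      triad
        (fun a : Fin n × Fin n =>
          if (e a.1).1 = p.2.1 ∧ (e a.2).1 = p.2.2.2 then w p.1 ((e a.1).2, (e a.2).2) else 0)
        (fun b : Fin n × Fin n =>
          if (e b.1).1 = p.2.1 ∧ (e b.2).1 = p.2.2.1 then u p.1 ((e b.1).2, (e b.2).2) else 0)
        (fun c : Fin n × Fin n =>
          if (e c.1).1 = p.2.2.1 ∧ (e c.2).1 = p.2.2.2 then v p.1 ((e c.1).2, (e c.2).2) else 0) := by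
  classical
  funext a b c
  rw [Finset.sum_apply, Finset.sum_apply, Finset.sum_apply]
  simp only [triad_apply]
  -- entries of `⟨m,m,m⟩` from the given decomposition
  have hm : ∀ α β γ : Fin m × Fin m,
      ∑ l, w l α * u l β * v l γ = matMulTensor ℂ m m m α β γ := by
    intro α β γ
    have h' := congrFun (congrFun (congrFun h α) β) γ
    rw [Finset.sum_apply, Finset.sum_apply, Finset.sum_apply] at h'
    simpa only [triad_apply] using h'.symm
  -- the block conditions are equivalent, via injectivity of `e`, to the defining condition
  have hiff : (a.1 = b.1 ∧ b.2 = c.1 ∧ a.2 = c.2) ↔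
      (((e b.1).1 = (e a.1).1 ∧ (e c.1).1 = (e b.2).1 ∧ (e c.2).1 = (e a.2).1) ∧
        ((e a.1).2 = (e b.1).2 ∧ (e b.2).2 = (e c.1).2 ∧ (e a.2).2 = (e c.2).2)) := by
    rw [← he.eq_iff (a := a.1) (b := b.1), ← he.eq_iff (a := b.2) (b := c.1),
      ← he.eq_iff (a := a.2) (b := c.2), Prod.ext_iff, Prod.ext_iff, Prod.ext_iff]
    constructor
    · rintro ⟨⟨h₁, h₁'⟩, ⟨h₂, h₂'⟩, ⟨h₃, h₃'⟩⟩
      exact ⟨⟨h₁.symm, h₂.symm, h₃.symm⟩, h₁', h₂', h₃'⟩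
    · rintro ⟨⟨h₁, h₂, h₃⟩, h₁', h₂', h₃'⟩
      exact ⟨⟨h₁.symm, h₁'⟩, ⟨h₂.symm, h₂'⟩, ⟨h₃.symm, h₃'⟩⟩
  rw [Fintype.sum_prod_type]
  symm
  calc
      _ = ∑ l : Fin R,
            (if (e b.1).1 = (e a.1).1 ∧ (e c.1).1 = (e b.2).1 ∧ (e c.2).1 = (e a.2).1 then
              w l ((e a.1).2, (e a.2).2) * u l ((e b.1).2, (e b.2).2) *
                v l ((e c.1).2, (e c.2).2)
            else 0) := by
        refine Finset.sum_congr rfl fun l _ => ?_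
        rw [Fintype.sum_eq_single ((e a.1).1, (e b.2).1, (e a.2).1)]
        · by_cases h₁ : (e b.1).1 = (e a.1).1 <;> by_cases h₂ : (e c.1).1 = (e b.2).1 <;>
            by_cases h₃ : (e c.2).1 = (e a.2).1 <;> simp [h₁, h₂, h₃]
        · rintro ⟨I, J, K⟩ hne
          simp only [ne_eq, Prod.mk.injEq, not_and] at hne
          by_cases hI : I = (e a.1).1
          · subst hI
            by_cases hJ : J = (e b.2).1
            · subst hJ
              have hK : K ≠ (e a.2).1 := hne rfl rfl
              simp [Ne.symm hK]
            · simp [Ne.symm hJ]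
          · simp [Ne.symm hI]
    _ = if (e b.1).1 = (e a.1).1 ∧ (e c.1).1 = (e b.2).1 ∧ (e c.2).1 = (e a.2).1 then
          matMulTensor ℂ m m m ((e a.1).2, (e a.2).2) ((e b.1).2, (e b.2).2)
            ((e c.1).2, (e c.2).2) else 0 := by
      split_ifs
      · exact hm _ _ _
      · simp
    _ = matMulTensor ℂ n n n a b c := by
      simp only [matMulTensor]
      by_cases hc : (e b.1).1 = (e a.1).1 ∧ (e c.1).1 = (e b.2).1 ∧ (e c.2).1 = (e a.2).1
      · rw [if_pos hc]
        by_cases hc₂ : (e a.1).2 = (e b.1).2 ∧ (e b.2).2 = (e c.1).2 ∧ (e a.2).2 = (e c.2).2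
        · rw [if_pos hc₂, if_pos (hiff.2 ⟨hc, hc₂⟩)]
        · rw [if_neg hc₂, if_neg fun h₃ => hc₂ (hiff.1 h₃).2]
      · rw [if_neg hc, if_neg fun h₃ => hc (hiff.1 h₃).1]

/-- Block recursion with probe-rank bookkeeping: if `n ≤ q·m`, a decomposition of `⟨m,m,m⟩` into
`R` triads yields a decomposition of `⟨n,n,n⟩` into `R·q³` triads all of whose probes (three legs)
have matrix rank `≤ m` (recursion bound `R_m(n) ≤ R(⟨m⟩)·q³` of the probe-rank filtration).
[folklore] -/
theorem exists_blockDecomposition {n m q R : ℕ} (hn : n ≤ q * m)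
    (w u v : Fin R → Fin m × Fin m → ℂ)
    (h : matMulTensor ℂ m m m = ∑ l, triad (w l) (u l) (v l)) :
    ∃ (w' u' v' : Fin (R * q ^ 3) → Fin n × Fin n → ℂ),
      matMulTensor ℂ n n n = ∑ l, triad (w' l) (u' l) (v' l) ∧
      ∀ l, (Matrix.of (Function.curry (w' l))).rank ≤ m ∧
        (Matrix.of (Function.curry (u' l))).rank ≤ m ∧
        (Matrix.of (Function.curry (v' l))).rank ≤ m := by
  classical
  -- block index and offset of every index of `⟨n,n,n⟩`
  let e : Fin n → Fin q × Fin m := fun i => finProdFinEquiv.symm (Fin.castLE hn i)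
  have he : Function.Injective e :=
    finProdFinEquiv.symm.injective.comp (Fin.castLE_injective hn)
  have hcard : Fintype.card (Fin R × Fin q × Fin q × Fin q) = R * q ^ 3 := by
    simp only [Fintype.card_prod, Fintype.card_fin]; ring
  let σ : Fin (R * q ^ 3) ≃ Fin R × Fin q × Fin q × Fin q := (Fintype.equivFinOfCardEq hcard).symm
  refine ⟨fun l a => if (e a.1).1 = (σ l).2.1 ∧ (e a.2).1 = (σ l).2.2.2 then
      w (σ l).1 ((e a.1).2, (e a.2).2) else 0,
    fun l b => if (e b.1).1 = (σ l).2.1 ∧ (e b.2).1 = (σ l).2.2.1 then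
      u (σ l).1 ((e b.1).2, (e b.2).2) else 0,
    fun l c => if (e c.1).1 = (σ l).2.2.1 ∧ (e c.2).1 = (σ l).2.2.2 then
      v (σ l).1 ((e c.1).2, (e c.2).2) else 0, ?_,
    fun l => ⟨rank_blockProbe_le e _ _ _, rank_blockProbe_le e _ _ _, rank_blockProbe_le e _ _ _⟩⟩
  rw [matMulTensor_eq_sum_blockTriad e he w u v h]
  exact (Fintype.sum_equiv σ _ _ fun l => rfl).symm

/-- **`HalfScaleTransfer`** (item stmt-MatrixMultiplication-10208 of route ProbeRankScaling): for
`δ > 0`, an infinitely-often lower bound `n^(5/2+δ)` on the number of terms of every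
decomposition of `⟨n,n,n⟩` over `ℂ` with all probe ranks `≤ √n` forces
`m^(2+δ) < R(⟨m,m,m⟩)` for infinitely many `m` (block recursion from `⟨⌊√n⌋⟩` with the
schoolbook algorithm and zero-padding). [folklore] -/
theorem halfScaleTransfer_proof :
    Summit.MatrixMultiplication.MatrixMultiplication.Theses.ProbeRankScaling.HalfScaleTransfer := by
  intro δ hδ hX n₀
  -- threshold beyond which `27 < m^δ`
  obtain ⟨N₁, hN₁⟩ : ∃ N₁ : ℕ, ∀ m : ℕ, N₁ ≤ m → (27 : ℝ) < (m : ℝ) ^ δ := by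
    have ht : Tendsto (fun m : ℕ => (m : ℝ) ^ δ) atTop atTop :=
      (tendsto_rpow_atTop hδ).comp tendsto_natCast_atTop_atTop
    obtain ⟨N, hN⟩ := eventually_atTop.1 (ht.eventually_gt_atTop 27)
    exact ⟨N, hN⟩
  set M : ℕ := max (max n₀ N₁) 1 with hM
  obtain ⟨n, hn, hP⟩ := hX (M * M)
  set m : ℕ := Nat.sqrt n with hm
  have hMm : M ≤ m := Nat.le_sqrt.2 hn
  have hn₀m : n₀ ≤ m := le_trans (le_trans (le_max_left _ _) (le_max_left _ _)) hMm
  have hN₁m : N₁ ≤ m := le_trans (le_trans (le_max_right _ _) (le_max_left _ _)) hMm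
  have hm1 : 1 ≤ m := le_trans (le_max_right _ _) hMm
  have hmm : m * m ≤ n := Nat.sqrt_le n
  have hnm : n ≤ (m + 2) * m := by
    have h := Nat.sqrt_le_add n
    rw [← hm] at h
    calc n ≤ m * m + m + m := h
      _ = (m + 2) * m := by ring
  -- a rank-attaining decomposition of `⟨m,m,m⟩`, block-embedded into `⟨n,n,n⟩`
  obtain ⟨w, u, v, hdec⟩ := exists_triad_decomposition_tensorRank (matMulTensor ℂ m m m)
  obtain ⟨w', u', v', hdec', hrk⟩ := exists_blockDecomposition hnm w u v hdec
  have hsq : ∀ k : ℕ, k ≤ m → k ^ 2 ≤ n := fun k hk =>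
    calc k ^ 2 = k * k := sq k
      _ ≤ m * m := Nat.mul_le_mul hk hk
      _ ≤ n := hmm
  have hbound := hP _ w' u' v' hdec'
    (fun l => ⟨hsq _ (hrk l).1, hsq _ (hrk l).2.1, hsq _ (hrk l).2.2⟩)
  refine ⟨m, hn₀m, ?_⟩
  -- real bookkeeping
  set R : ℕ := tensorRank (matMulTensor ℂ m m m) with hR
  have hm0 : (0 : ℝ) < m := by exact_mod_cast hm1
  have h27 : (27 : ℝ) < (m : ℝ) ^ δ := hN₁ m hN₁m
  by_contra hcon
  rw [not_lt] at hcon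
  have h1 : (m : ℝ) ^ (5 + 2 * δ) ≤ (n : ℝ) ^ ((5 : ℝ) / 2 + δ) := by
    have hmm' : (m : ℝ) * m ≤ n := by exact_mod_cast hmm
    calc (m : ℝ) ^ (5 + 2 * δ) = ((m : ℝ) * m) ^ ((5 : ℝ) / 2 + δ) := by
          rw [← pow_two, ← Real.rpow_natCast_mul hm0.le]
          congr 1; push_cast; ring
      _ ≤ (n : ℝ) ^ ((5 : ℝ) / 2 + δ) :=
          Real.rpow_le_rpow (by positivity) hmm' (by positivity)
  have h2 : (n : ℝ) ^ ((5 : ℝ) / 2 + δ) ≤ (R : ℝ) * ((m : ℝ) + 2) ^ 3 := by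
    have h' := hbound
    push_cast at h'
    exact h'
  have h3 : (R : ℝ) * ((m : ℝ) + 2) ^ 3 ≤ (m : ℝ) ^ (2 + δ) * (27 * (m : ℝ) ^ 3) := by
    apply mul_le_mul hcon _ (by positivity) (by positivity)
    have h1m : (1 : ℝ) ≤ m := by exact_mod_cast hm1
    have h3m : (m : ℝ) + 2 ≤ 3 * m := by linarith
    calc ((m : ℝ) + 2) ^ 3 ≤ (3 * (m : ℝ)) ^ 3 := by gcongr
      _ = 27 * (m : ℝ) ^ 3 := by ring
  have h4 : (m : ℝ) ^ (2 + δ) * (27 * (m : ℝ) ^ 3) <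
      (m : ℝ) ^ (2 + δ) * ((m : ℝ) ^ δ * (m : ℝ) ^ 3) :=
    mul_lt_mul_of_pos_left (mul_lt_mul_of_pos_right h27 (by positivity))
      (Real.rpow_pos_of_pos hm0 _)
  have h5 : (m : ℝ) ^ (2 + δ) * ((m : ℝ) ^ δ * (m : ℝ) ^ 3) = (m : ℝ) ^ (5 + 2 * δ) := by
    rw [← Real.rpow_natCast (m : ℝ) 3, ← Real.rpow_add hm0, ← Real.rpow_add hm0]
    congr 1; push_cast; ring
  linarith

end Summit.MatrixMultiplication.MatrixMultiplication.Theorems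

end
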